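import Summits.BirchSwinnertonDyer.BirchSwinnertonDyer.Theses.SmallImageMuTransfer
import Summits.BirchSwinnertonDyer.Rank1Residual.X9.SurjKatoCertificateRoute
import HarnessLib

/-!
# Route `SmallImageMuTransfer` (rung K6), crux `MuTransfer` (stmt-BirchSwinnertonDyer-19629):
# the SURJECTIVE-image stub `stub_surj` of the registered birth skeleton, closed CONDITIONALLY on
# its two published inputs (Kato 2004 Thm. 17.4, BCS 2025 Thm. 1.1.2 (a))

Cell `bsd-smallim`, seat `bsd-smallim-koly` (prover, gen 4).  The registered BC3 skeleton
`Cruxes/MuTransfer/Lines/birth.lean` (planner `bsd-smallim-plan` g2/g3; HOME copy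
`plan/k6/lines/MuTransfer_birth.lean`, v2 sha e56656b3) decomposes the crux
`Theses.SmallImageMuTransfer.MuTransfer := Rank1Residual.KatoMuTransfer` into three stubs by excluded
middle on surjectivity and on CM: `stub_surj` (PUB-conditional), `stub_cm` (PUB-conditional, Rubin 1991
Thm. 12.3) and `stub_x9` (the cell's open content, KOLY-MEMO §5.7).  This file lands the FIRST of the
two conditional closers asked for by the referee's road (ii) (REF-KOLY-VERDICT v8-3) and the planner's
D-0074 fragment (first task of row `bsd-smallim-k6-c2`):

* `smallImageMuTransfer_stub_surj_of_kato_of_bcs` — the registered signature of `stub_surj`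
  VERBATIM, under the two named-fact binders `hKato` (the tree's `kato_divisibility`, Kato 2004
  Thm. 17.4, for every curve, prime, cyclotomic datum and newform) and `hBCS` (the tree's
  `burungale_castella_skinner_charIdeal_eq_padicLFunction`, BCS 2025 Thm. 1.1.2 (a)).  The proof is a
  re-export of the X9 seat's kernel theorem
  `Summit.BirchSwinnertonDyer.Rank1Residual.mu_eq_zero_of_surj_of_kato_of_unitCoeff`
  (`Rank1Residual/X9/SurjKatoCertificateRoute.lean`): surjectivity at `p ≥ 5` gives Kato's (12.5.2),
  clause (3) gives `g₁ ∈ char X` with `ι g₁ = L_p(f, α)`, the certificate makes `μ(g₁) = 0`, BCS (a)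
  makes `char X` principal, so `μ(X) = 0`.

What this is NOT: it does not close `stub_surj` as REGISTERED (which has no fact binders) — it is the
`(hKato, hBCS) →` form, a CONDITIONAL result on two PUBLISHED theorems, attached to the crux item as
support (`--supports stmt-BirchSwinnertonDyer-19629`); nothing is asserted about any curve; the
irreducibility binder of the stub is not used (it follows from surjectivity).  PARTITION (D-0054):
X9 (A4) × `p ∈ {5,7}` — closes NONE (the surjective branch is the COVERED cell C2, outside X9).
-/

set_option linter.dupNamespace false
set_option autoImplicit false

noncomputable section

open scoped Classical MatrixGroups ModularForm
open CongruenceSubgroup WeierstrassCurve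
open Literature.NumberTheory.EllipticCurves Literature.NumberTheory.EllipticCurves.ModularForms

namespace Summit.BirchSwinnertonDyer.BirchSwinnertonDyer.Theorems

/-- **`stub_surj` of the `MuTransfer` birth skeleton, conditionally on Kato 17.4 and BCS 1.1.2 (a).**
For a globally minimal `W/ℚ`, a prime `p ≥ 5` of good ordinary reduction with `ρ̄_{E,p}` SURJECTIVE,
the newform `f` of `W` (any level carrying `IsNewformOf W f`) and ONE coefficient of `L_p(f, α)` of norm
`1`: every cyclotomic Selmer-dual datum has `μ = 0`.  Binders: `hKato` = `kato_divisibility` (Kato, Astérisque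
295 (2004), Thm. 17.4) for all data; `hBCS` = `burungale_castella_skinner_charIdeal_eq_padicLFunction`
(Burungale–Castella–Skinner, IMRN 2025, Thm. 1.1.2 (a)).  Proof: the X9 seat's
`Rank1Residual.mu_eq_zero_of_surj_of_kato_of_unitCoeff`.  The statement after the two binders is the
registered stub signature verbatim. [cite: Kato2004Asterisque, Thm. 17.4 (3) (p. 273)]
[cite: BurungaleCastellaSkinner2025, Thm. 1.1.2 (a)] -/
theorem smallImageMuTransfer_stub_surj_of_kato_of_bcs
    (hKato : ∀ (W : WeierstrassCurve ℚ) [W.IsElliptic] [W.IsGloballyMinimal] (p : ℕ) [Fact p.Prime]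
      (κ : ZpExtension ℚ p) (γ : Field.absoluteGaloisGroup ℚ) (N : ℕ) [NeZero N]
      (f : CuspForm (Gamma0 N) 2), kato_divisibility W p (κ := κ) (γ := γ) (f := f))
    (hBCS : burungale_castella_skinner_charIdeal_eq_padicLFunction) :
    ∀ (W : WeierstrassCurve ℚ) [W.IsElliptic] [W.IsGloballyMinimal] (p : ℕ) [Fact p.Prime]
      {N : ℕ} [NeZero N] (f : CuspForm (Gamma0 N) 2),
      5 ≤ p → W.HasGoodReductionAtPrime p → ¬ (p : ℤ) ∣ W.frobeniusTrace p →
      W.HasIrreducibleModPGaloisRep p → W.HasSurjectiveModNGaloisRep p → IsNewformOf W f →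
      (∃ n : ℕ, ‖PowerSeries.coeff n (padicLFunction f (unitRoot W p : ℚ_[p]))‖ = 1) →
      ∀ (κ : ZpExtension ℚ p) (γ : Field.absoluteGaloisGroup ℚ),
        κ.IsCyclotomic → κ.IsTopGenerator γ → IsCyclotomicVariable p γ →
        ∀ D : W.SelmerDualData κ γ, D.mu = 0 := by
  intro W _ _ p _ N _ f hp hgood hord _hirr hsurj hf hcert κ γ hκ hγ hγ' D
  exact Summit.BirchSwinnertonDyer.Rank1Residual.mu_eq_zero_of_surj_of_kato_of_unitCoeff
    (W := W) (p := p) (fun κ' γ' N' _ f' => hKato W p κ' γ' N' f') hBCS hp ⟨hgood, hord⟩ hsurj f hf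
    hcert κ γ hκ hγ hγ' D

end Summit.BirchSwinnertonDyer.BirchSwinnertonDyer.Theorems

end
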